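import Summits.QuantumFields.YangMills.Theorems.ColdStartUniversalityLatticeLangevinGeneratorCalculus
import Mathlib.Analysis.Calculus.FDeriv.Symmetric
import Mathlib.Analysis.Calculus.FDeriv.CompCLM
import Mathlib.Analysis.Calculus.ContDiff.Operations
import Mathlib.Algebra.BigOperators.Ring.Finset
import HarnessLib

/-!
# Route `ColdStartUniversality` (fixed-cut-off package, Bakry–Émery side): FRAME CALCULUS — directional derivatives along
# LINEAR vector fields, their commutators, and the three antisymmetry cancellations of Bochner's formula

Helper file (seat `ym-line-csu-p1`, g25; `--supports stmt-QuantumFields-24809`).  Abstract differential calculus on a real normed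
space `E` for the "frame derivatives" `W_s g (y) := Dg(y)[s y]` along continuous LINEAR vector fields `s : E →L[ℝ] E` — the shape of
the noise fields `y ↦ √2·𝐩(E_ν)·Q_e` of the SU(2) lattice Langevin dynamics of Shen–Zhu–Zhu read in the real link coordinates
(`dynkin_expectation_szz`), in which the SZZ coordinate generator is `½ Σ_n (W_n W_n + (W_n ψ̂) W_n)` (sequel files).  Contents:

* §1 one field: `contDiff_frameDeriv`, `fderiv_frameDeriv_apply` (`∂_w (Dg[s·]) = D²g[w, s y] + Dg[s w]`), ★ `frameDeriv_comm`
  (`[W_t, W_s] g = Dg[s(t y) − t(s y)]`: second derivatives cancel by symmetry), chain rules for `exp`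
  (Leibniz / linear combinations are `fderiv_mul_apply_dir` / `fderiv_sum_mul_apply` of `…GeneratorCalculus`);
* §2 finite-sum algebra of a structure tensor `c n m k` antisymmetric in its last two slots: `Σ_{nm} a_n b_m Σ_k c_{mnk} a_k = 0`,
  `Σ_{nm} a_n Σ_k c_{nmk}(T_{km} + T_{mk}) = 0`, and `¼ Σ_{nm} (T_{mn} − T_{nm})² ≤ Σ_{nm} T_{mn}²`;
* §3 a finite frame `s : ι → E →L[ℝ] E` closing under brackets, `s_m ∘ s_n − s_n ∘ s_m = Σ_k c_{nmk} s_k` (`c` antisymmetric in the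
  last two slots — the right-invariant frame of a compact Lie group): ★ the three cancellations entering Bochner's `Γ₂` formula for
  `𝓛 = Σ_n W_n² + (W_nψ)W_n`: `Σ_{nm} W_ng · [W_n, W_m²] g = 0` (`C³`), `Σ_{nm} W_ng · W_mψ · [W_m,W_n]g = 0`, and the curvature term
  `¼ Σ_{nm} ([W_n,W_m]g)² ≤ Σ_{nm} (W_nW_mg)²`.
THEOREMS ONLY, no definition, no sorry; all [folklore] (Bakry–Émery 1985 / Bakry–Gentil–Ledoux 2014 §1.16, §C.5 bookkeeping).
HONEST FRAMING: pure calculus; no statement about Yang–Mills; nothing K-uniform; the YM mass gap is NOT proved.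
-/

set_option autoImplicit false

noncomputable section

namespace Summit.QuantumFields.YangMills.Theorems.ColdStartUniversality

open Finset
open scoped BigOperators

variable {E : Type*} [NormedAddCommGroup E] [NormedSpace ℝ E]

/-! ## §1. Frame derivatives along one linear field -/

/-- `z ↦ Dg(z)[s z]` is `C^k` when `g` is `C^{k+1}` and `s` is continuous linear. [folklore] -/
theorem contDiff_frameDeriv {g : E → ℝ} {k : ℕ} (hg : ContDiff ℝ (k + 1) g) (s : E →L[ℝ] E) :
    ContDiff ℝ k (fun z => fderiv ℝ g z (s z)) := by
  have h1 : ContDiff ℝ k (fderiv ℝ g) := hg.fderiv_right (m := k) le_rfl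
  exact h1.clm_apply (s.contDiff.of_le le_top)

/-- `z ↦ Dg(z)[s z]` is differentiable when `g` is `C²`. [folklore] -/
theorem differentiableAt_frameDeriv {g : E → ℝ} (hg : ContDiff ℝ 2 g) (s : E →L[ℝ] E) (y : E) :
    DifferentiableAt ℝ (fun z => fderiv ℝ g z (s z)) y :=
  ((contDiff_frameDeriv (k := 1) hg s).differentiable (by norm_num)).differentiableAt

/-- **Derivative of a frame derivative**: `∂_w (z ↦ Dg(z)[s z]) (y) = D²g(y)[w][s y] + Dg(y)[s w]` (the field is linear,
so its own derivative is itself). [folklore] -/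
theorem fderiv_frameDeriv_apply {g : E → ℝ} (hg : ContDiff ℝ 2 g) (s : E →L[ℝ] E) (y w : E) :
    fderiv ℝ (fun z => fderiv ℝ g z (s z)) y w = fderiv ℝ (fderiv ℝ g) y w (s y) + fderiv ℝ g y (s w) := by
  have hd : DifferentiableAt ℝ (fderiv ℝ g) y :=
    ((hg.fderiv_right (m := 1) (by norm_num)).differentiable (by norm_num)).differentiableAt
  rw [fderiv_clm_apply hd s.differentiableAt]
  simp only [add_apply, ContinuousLinearMap.comp_apply, ContinuousLinearMap.flip_apply,
    ContinuousLinearMap.fderiv]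
  ring

/-- ★ **Commutator of two frame derivatives**: `W_t(W_s g) − W_s(W_t g) = Dg[s(t y) − t(s y)]` — the second derivatives cancel by
the symmetry of `D²g` (`C²`). [folklore] -/
theorem frameDeriv_comm {g : E → ℝ} (hg : ContDiff ℝ 2 g) (s t : E →L[ℝ] E) (y : E) :
    fderiv ℝ (fun z => fderiv ℝ g z (s z)) y (t y) - fderiv ℝ (fun z => fderiv ℝ g z (t z)) y (s y) =
      fderiv ℝ g y (s (t y) - t (s y)) := by
  rw [fderiv_frameDeriv_apply hg s y (t y), fderiv_frameDeriv_apply hg t y (s y)]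
  have hsymm : fderiv ℝ (fderiv ℝ g) y (t y) (s y) = fderiv ℝ (fderiv ℝ g) y (s y) (t y) :=
    (hg.contDiffAt.isSymmSndFDerivAt (by simp)).eq _ _
  rw [hsymm, map_sub]
  ring

/-- Chain rule along a field for the exponential: `W_s(e^u) = e^u W_s u`. [folklore] -/
theorem frameDeriv_exp {u : E → ℝ} {y : E} (hu : DifferentiableAt ℝ u y) (v : E) :
    fderiv ℝ (fun z => Real.exp (u z)) y v = Real.exp (u y) * fderiv ℝ u y v := by
  have h := fderiv_exp_const_mul_apply hu 1 v
  simp only [one_mul] at h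
  exact h

/-- Second frame derivative of the exponential: `W_t W_s (e^u) = e^u (W_t W_s u + W_t u · W_s u)`. [folklore] -/
theorem fderiv_frameDeriv_exp {u : E → ℝ} (hu : ContDiff ℝ 2 u) (s : E →L[ℝ] E) (y w : E) :
    fderiv ℝ (fun z => fderiv ℝ (fun z' => Real.exp (u z')) z (s z)) y w =
      Real.exp (u y) * (fderiv ℝ (fun z => fderiv ℝ u z (s z)) y w + fderiv ℝ u y w * fderiv ℝ u y (s y)) := by
  have hud : Differentiable ℝ u := hu.differentiable (by norm_num)
  have h1 : (fun z => fderiv ℝ (fun z' => Real.exp (u z')) z (s z)) =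
      fun z => Real.exp (u z) * fderiv ℝ u z (s z) := by
    funext z; exact frameDeriv_exp (hud z) (s z)
  rw [h1, fderiv_mul_apply_dir (hud y).exp (differentiableAt_frameDeriv hu s y), frameDeriv_exp (hud y)]
  ring

/-! ## §2. Finite-sum algebra of an antisymmetric structure tensor -/

section Algebra

variable {ι : Type*} [Fintype ι]

/-- `Σ_n Σ_k c_{m n k} a_n a_k = 0` when `c_{m·· }` is antisymmetric. [folklore] -/
theorem sum_sum_antisymm_mul_mul_eq_zero (a : ι → ℝ) (c : ι → ι → ι → ℝ) (hc : ∀ n m k, c n m k = -c n k m) (m : ι) :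
    ∑ n, ∑ k, c m n k * a n * a k = 0 := by
  have h : ∑ n, ∑ k, c m n k * a n * a k = -∑ n, ∑ k, c m n k * a n * a k := by
    conv_lhs => rw [Finset.sum_comm]
    rw [← Finset.sum_neg_distrib]
    refine Finset.sum_congr rfl fun n _ => ?_
    rw [← Finset.sum_neg_distrib]
    refine Finset.sum_congr rfl fun k _ => ?_
    rw [hc m k n]
    ring
  linarith

/-- **First cancellation**: `Σ_{n,m} a_n b_m Σ_k c_{m n k} a_k = 0`. [folklore] -/
theorem sum_sum_mul_mul_sum_antisymm_eq_zero (a b : ι → ℝ) (c : ι → ι → ι → ℝ)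
    (hc : ∀ n m k, c n m k = -c n k m) :
    ∑ n, ∑ m, a n * b m * ∑ k, c m n k * a k = 0 := by
  rw [Finset.sum_comm]
  refine Finset.sum_eq_zero fun m _ => ?_
  have h := sum_sum_antisymm_mul_mul_eq_zero a c hc m
  calc ∑ n, a n * b m * ∑ k, c m n k * a k = b m * ∑ n, ∑ k, c m n k * a n * a k := by
        rw [Finset.mul_sum]
        refine Finset.sum_congr rfl fun n _ => ?_
        rw [Finset.mul_sum, Finset.mul_sum]
        refine Finset.sum_congr rfl fun k _ => ?_
        ring
    _ = 0 := by rw [h, mul_zero]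

/-- **Second cancellation**: `Σ_{n,m} a_n Σ_k c_{n m k} (T_{k m} + T_{m k}) = 0` (antisymmetric against symmetric). [folklore] -/
theorem sum_sum_mul_sum_antisymm_symm_eq_zero (a : ι → ℝ) (T : ι → ι → ℝ) (c : ι → ι → ι → ℝ)
    (hc : ∀ n m k, c n m k = -c n k m) :
    ∑ n, ∑ m, a n * ∑ k, c n m k * (T k m + T m k) = 0 := by
  refine Finset.sum_eq_zero fun n _ => ?_
  rw [← Finset.mul_sum]
  have h : ∑ m, ∑ k, c n m k * (T k m + T m k) = -∑ m, ∑ k, c n m k * (T k m + T m k) := by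
    conv_lhs => rw [Finset.sum_comm]
    rw [← Finset.sum_neg_distrib]
    refine Finset.sum_congr rfl fun m _ => ?_
    rw [← Finset.sum_neg_distrib]
    refine Finset.sum_congr rfl fun k _ => ?_
    rw [hc n k m]
    ring
  have h0 : ∑ m, ∑ k, c n m k * (T k m + T m k) = 0 := by linarith
  rw [h0, mul_zero]

/-- **Curvature bookkeeping**: `¼ Σ_{n,m} (T_{m n} − T_{n m})² ≤ Σ_{n,m} T_{m n}²` (the antisymmetric part of a square array is
dominated by the whole in `ℓ²`). [folklore] -/
theorem quarter_sum_sum_sq_sub_le (T : ι → ι → ℝ) :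
    (1 / 4 : ℝ) * ∑ n, ∑ m, (T m n - T n m) ^ 2 ≤ ∑ n, ∑ m, T m n ^ 2 := by
  have hsymm : ∑ n, ∑ m, T n m ^ 2 = ∑ n, ∑ m, T m n ^ 2 := Finset.sum_comm
  have hpos : 0 ≤ ∑ n, ∑ m, (T m n + T n m) ^ 2 :=
    Finset.sum_nonneg fun _ _ => Finset.sum_nonneg fun _ _ => sq_nonneg _
  have hsum : ∑ n, ∑ m, (T m n - T n m) ^ 2 + ∑ n, ∑ m, (T m n + T n m) ^ 2 =
      2 * ∑ n, ∑ m, T m n ^ 2 + 2 * ∑ n, ∑ m, T n m ^ 2 := by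
    rw [← Finset.sum_add_distrib, Finset.mul_sum, Finset.mul_sum, ← Finset.sum_add_distrib]
    refine Finset.sum_congr rfl fun n _ => ?_
    rw [← Finset.sum_add_distrib, Finset.mul_sum, Finset.mul_sum, ← Finset.sum_add_distrib]
    refine Finset.sum_congr rfl fun m _ => ?_
    ring
  rw [hsymm] at hsum
  linarith

end Algebra

/-! ## §3. A finite frame closing under brackets: the three cancellations of Bochner's formula -/

section Frame

variable {ι : Type*} [Fintype ι]

/-- The bracket relation transported to frame derivatives: `W_n(W_m g) − W_m(W_n g) = Σ_k c_{n m k} W_k g`. [folklore] -/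
theorem frameDeriv_comm_of_bracket {g : E → ℝ} (hg : ContDiff ℝ 2 g) (s : ι → E →L[ℝ] E) (c : ι → ι → ι → ℝ)
    (hs : ∀ n m y, s m (s n y) - s n (s m y) = ∑ k, c n m k • s k y) (n m : ι) (y : E) :
    fderiv ℝ (fun z => fderiv ℝ g z (s m z)) y (s n y) - fderiv ℝ (fun z => fderiv ℝ g z (s n z)) y (s m y) =
      ∑ k, c n m k * fderiv ℝ g y (s k y) := by
  rw [frameDeriv_comm hg (s m) (s n) y, hs n m y, map_sum]
  refine Finset.sum_congr rfl fun k _ => ?_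
  rw [map_smul, smul_eq_mul]

/-- ★ **Cancellation I** (`C³`): `Σ_{n,m} W_n g · (W_n W_m W_m g − W_m W_m W_n g) = 0`, i.e. the third-order commutator term
`Σ_{n,m} W_ng · [W_n, W_m²] g` of Bochner's formula vanishes for a frame with antisymmetric structure tensor. [folklore] -/
theorem sum_sum_frameDeriv_mul_comm_sq_eq_zero {g : E → ℝ} (hg : ContDiff ℝ 3 g) (s : ι → E →L[ℝ] E)
    (c : ι → ι → ι → ℝ) (hs : ∀ n m y, s m (s n y) - s n (s m y) = ∑ k, c n m k • s k y)
    (hc : ∀ n m k, c n m k = -c n k m) (y : E) :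
    ∑ n, ∑ m, fderiv ℝ g y (s n y) *
      (fderiv ℝ (fun z => fderiv ℝ (fun w => fderiv ℝ g w (s m w)) z (s m z)) y (s n y) -
        fderiv ℝ (fun z => fderiv ℝ (fun w => fderiv ℝ g w (s n w)) z (s m z)) y (s m y)) = 0 := by
  have hg2 : ContDiff ℝ 2 g := hg.of_le (by norm_num)
  have hW2 : ∀ m, ContDiff ℝ 2 (fun w => fderiv ℝ g w (s m w)) := fun m => contDiff_frameDeriv (k := 2) hg (s m)
  have hW1 : ∀ m n, ContDiff ℝ 1 (fun z => fderiv ℝ (fun w => fderiv ℝ g w (s m w)) z (s n z)) :=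
    fun m n => contDiff_frameDeriv (k := 1) (hW2 m) (s n)
  -- the commutator identity, for each pair
  have hpair : ∀ n m,
      fderiv ℝ (fun z => fderiv ℝ (fun w => fderiv ℝ g w (s m w)) z (s m z)) y (s n y) -
        fderiv ℝ (fun z => fderiv ℝ (fun w => fderiv ℝ g w (s n w)) z (s m z)) y (s m y) =
      ∑ k, c n m k * (fderiv ℝ (fun z => fderiv ℝ g z (s m z)) y (s k y) +
        fderiv ℝ (fun z => fderiv ℝ g z (s k z)) y (s m y)) := by
    intro n m
    -- `[W_n, W_m] (W_m g)`
    have hA := frameDeriv_comm_of_bracket (hW2 m) s c hs n m y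
    -- `W_m ([W_n, W_m] g)`
    have hfun : (fun z => fderiv ℝ (fun w => fderiv ℝ g w (s m w)) z (s n z) -
        fderiv ℝ (fun w => fderiv ℝ g w (s n w)) z (s m z)) = fun z => ∑ k, c n m k * fderiv ℝ g z (s k z) := by
      funext z; exact frameDeriv_comm_of_bracket hg2 s c hs n m z
    have hB : fderiv ℝ (fun z => fderiv ℝ (fun w => fderiv ℝ g w (s m w)) z (s n z)) y (s m y) -
        fderiv ℝ (fun z => fderiv ℝ (fun w => fderiv ℝ g w (s n w)) z (s m z)) y (s m y) =
        ∑ k, c n m k * fderiv ℝ (fun z => fderiv ℝ g z (s k z)) y (s m y) := by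
      have hd1 : DifferentiableAt ℝ (fun z => fderiv ℝ (fun w => fderiv ℝ g w (s m w)) z (s n z)) y :=
        ((hW1 m n).differentiable (by norm_num)).differentiableAt
      have hd2 : DifferentiableAt ℝ (fun z => fderiv ℝ (fun w => fderiv ℝ g w (s n w)) z (s m z)) y :=
        ((hW1 n m).differentiable (by norm_num)).differentiableAt
      have h1 := fderiv_fun_sub hd1 hd2
      have h2 : fderiv ℝ (fun z => fderiv ℝ (fun w => fderiv ℝ g w (s m w)) z (s n z) -
          fderiv ℝ (fun w => fderiv ℝ g w (s n w)) z (s m z)) y (s m y) =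
          ∑ k, c n m k * fderiv ℝ (fun z => fderiv ℝ g z (s k z)) y (s m y) := by
        rw [hfun]
        exact fderiv_sum_mul_apply Finset.univ (c n m) (fun k _ => differentiableAt_frameDeriv hg2 (s k) y) (s m y)
      rw [h1, _root_.sub_apply] at h2
      exact h2
    have hsplit : fderiv ℝ (fun z => fderiv ℝ (fun w => fderiv ℝ g w (s m w)) z (s m z)) y (s n y) -
        fderiv ℝ (fun z => fderiv ℝ (fun w => fderiv ℝ g w (s n w)) z (s m z)) y (s m y) =
        (fderiv ℝ (fun z => fderiv ℝ (fun w => fderiv ℝ g w (s m w)) z (s m z)) y (s n y) -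
          fderiv ℝ (fun z => fderiv ℝ (fun w => fderiv ℝ g w (s m w)) z (s n z)) y (s m y)) +
        (fderiv ℝ (fun z => fderiv ℝ (fun w => fderiv ℝ g w (s m w)) z (s n z)) y (s m y) -
          fderiv ℝ (fun z => fderiv ℝ (fun w => fderiv ℝ g w (s n w)) z (s m z)) y (s m y)) := by ring
    rw [hsplit, hA, hB, ← Finset.sum_add_distrib]
    refine Finset.sum_congr rfl fun k _ => ?_
    ring
  simp_rw [hpair]
  exact sum_sum_mul_sum_antisymm_symm_eq_zero (fun n => fderiv ℝ g y (s n y))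
    (fun k m => fderiv ℝ (fun z => fderiv ℝ g z (s m z)) y (s k y)) c hc

/-- ★ **Cancellation II**: `Σ_{n,m} W_n g · W_m ψ · (W_m W_n g − W_n W_m g) = 0` (the first-order drift term of Bochner's formula
for `𝓛 = Σ W_n² + (W_nψ) W_n` produces no correction). [folklore] -/
theorem sum_sum_frameDeriv_mul_mul_comm_eq_zero {g ψ : E → ℝ} (hg : ContDiff ℝ 2 g) (s : ι → E →L[ℝ] E)
    (c : ι → ι → ι → ℝ) (hs : ∀ n m y, s m (s n y) - s n (s m y) = ∑ k, c n m k • s k y)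
    (hc : ∀ n m k, c n m k = -c n k m) (y : E) :
    ∑ n, ∑ m, fderiv ℝ g y (s n y) * fderiv ℝ ψ y (s m y) *
      (fderiv ℝ (fun z => fderiv ℝ g z (s n z)) y (s m y) - fderiv ℝ (fun z => fderiv ℝ g z (s m z)) y (s n y)) = 0 := by
  have hpair : ∀ n m, fderiv ℝ (fun z => fderiv ℝ g z (s n z)) y (s m y) -
      fderiv ℝ (fun z => fderiv ℝ g z (s m z)) y (s n y) = ∑ k, c m n k * fderiv ℝ g y (s k y) :=
    fun n m => frameDeriv_comm_of_bracket hg s c hs m n y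
  simp_rw [hpair]
  exact sum_sum_mul_mul_sum_antisymm_eq_zero (fun n => fderiv ℝ g y (s n y)) (fun m => fderiv ℝ ψ y (s m y)) c hc

/-- ★ **Curvature term**: `¼ Σ_{n,m} (Dg[s_m(s_n y) − s_n(s_m y)])² ≤ Σ_{n,m} (W_n W_m g)²` — the squared commutators
`([W_n, W_m] g)²` (which carry the Ricci curvature of the frame) are dominated by the full square of second frame derivatives. [folklore] -/
theorem quarter_sum_sum_sq_bracket_le {g : E → ℝ} (hg : ContDiff ℝ 2 g) (s : ι → E →L[ℝ] E) (y : E) :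
    (1 / 4 : ℝ) * ∑ n, ∑ m, (fderiv ℝ g y (s m (s n y) - s n (s m y))) ^ 2 ≤
      ∑ n, ∑ m, (fderiv ℝ (fun z => fderiv ℝ g z (s m z)) y (s n y)) ^ 2 := by
  have h := quarter_sum_sum_sq_sub_le (fun m n => fderiv ℝ (fun z => fderiv ℝ g z (s m z)) y (s n y))
  have hcomm : ∀ n m, fderiv ℝ (fun z => fderiv ℝ g z (s m z)) y (s n y) -
      fderiv ℝ (fun z => fderiv ℝ g z (s n z)) y (s m y) = fderiv ℝ g y (s m (s n y) - s n (s m y)) :=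
    fun n m => frameDeriv_comm hg (s m) (s n) y
  simp_rw [hcomm] at h
  exact h

end Frame

end Summit.QuantumFields.YangMills.Theorems.ColdStartUniversality
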